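import Summits.QuantumFields.QCD.Theses.PauliWegnerSea
import Summits.QuantumFields.QCD.Theorems.PauliWegnerSeaTiltedFlatness
import Summits.QuantumFields.QCD.Theorems.PauliWegnerSeaOneScaleTrajectoryStubAdjugateBandLimit
import Literature.MathematicalPhysics.QuantumFieldTheory.QCDPhaseQuenched

/-!
# Stub `stub_adjugateSmallBall` of line `adjugate-anticoncentration-pin`
(crux `Summit.QuantumFields.QCD.Theses.PauliWegnerSea.OneScaleTrajectory`, item stmt-QuantumFields-11513)

**What is proved.** `stub_adjugateSmallBall`: RELATIVE SMALL BALLS FOR THE COFACTOR BLOCK under the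
tilted two-star law.  On the fibre of the `≤ 16` links of `star(x) ∪ star(y)` (all other links frozen
to `U`, `refit`), with `A(W) = Σ_{a,i,b,j} |adj D_W(refit W)_{(x,a,i),(y,b,j)}|` the `ℓ¹` colour–spin
block of the adjugate of the one-flavour `r = 1` Wilson–Dirac matrix (`|m₀| ≤ 2`, `L ≥ 4`), weight
`wt = e^{-β S_W ∘ refit}`, product Haar, `Z = ∫ wt`, `M = ∫ A wt / Z > 0`:
`∫ 1{A ≤ ε M} wt / Z ≤ C (1+β)^p ε^c`, constants absolute.

**Proof.** The adjugate twin of crux `TiltedFlatness` (b′) (`CircleTransport.TiltedFlatness_proof`),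
run through the same generic engine at the diagonal circle `T` (`CircleTransport.exists_diagCircle`):
(1) by the one-link band limit of the cofactors (`stub_adjugateBandLimit`, degree `24`) and
`refit ∘ update = update ∘ refit` on star edges, `Q = Σ |adj|²` is along every star-link circle a
trigonometric polynomial of degree `≤ 48` (`|F|² = F · conj F`, products and sums of Fourier sums:
`fs_conj`, `fs_mul`, `fs_sum`, `fs_norm_sq`); (2) the abstract Haar small balls
(`CircleTransport.stub_haarSmallBalls` ∘ `stub_torusSmallBalls` ∘ `stub_circleEngine`, with the
surjective word `stub_eulerWord`) applied to `G = √Q` (continuous, `≥ 0`, reads only the listed star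
links `CircleTransport.exists_starEdge`) give `Haar{G ≤ ε G(W₀)} ≤ C_R ε^c`; (3) `G ≤ A ≤ 12 G`
(`Σ z² ≤ (Σ z)²`, Cauchy–Schwarz over `144` entries), so `A` has relative Haar small balls with
constant `C_R 12^c`; (4) the density bound `wt / Z ≤ C_D (1+β)^p`
(`CircleTransport.tiltDensityBound_of_fibre` with `stub_actionLipschitz`, `stub_circleUntilt`) and the
tilted anti-concentration lemma `Literature.MeasureTheory.Integral.flatness_and_smallBalls_of_anticoncentration`
(clause (b)) give the claim with `C = C_D C_R 12^c`, `p = p_D`, `c = c_R`.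

Sources: folklore (Haar averaging along one-parameter subgroups, Remez-type small balls for
trigonometric polynomials); line card `adjugate-anticoncentration-pin`; the sibling crux file
`PauliWegnerSeaTiltedFlatness.lean`.
-/

noncomputable section

namespace Summit.QuantumFields.QCD.Theorems.AdjugateAnticoncentrationPin

open scoped BigOperators ENNReal
open MeasureTheory Filter Set
open Literature.MathematicalPhysics.QuantumFieldTheory Literature.MathematicalPhysics.QuantumLattice
  Literature.Probability.LatticeModels

/-! ### Fourier sums `∑_{|k| ≤ n} a_k e^{ikt}`: conjugates, products, sums, squared moduli -/

section Fourier

open Complex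

/-- The conjugate of a Fourier sum of degree `n` is a Fourier sum of degree `n`
(`conj e^{ikt} = e^{-ikt}`, reindex `k ↦ -k`). -/
private theorem fs_conj {n : ℕ} {F : ℝ → ℂ} {a : ℤ → ℂ}
    (hF : ∀ t : ℝ, F t = ∑ k ∈ Finset.Icc (-(n : ℤ)) n, a k * exp ((k : ℂ) * (t : ℂ) * I)) :
    ∀ t : ℝ, (starRingEnd ℂ) (F t) =
      ∑ k ∈ Finset.Icc (-(n : ℤ)) n, (starRingEnd ℂ) (a (-k)) * exp ((k : ℂ) * (t : ℂ) * I) := by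
  intro t
  rw [hF t, map_sum]
  refine Finset.sum_nbij' (fun k => -k) (fun k => -k) (fun k hk => ?_) (fun k hk => ?_)
    (fun k _ => neg_neg k) (fun k _ => neg_neg k) fun k _ => ?_
  · simp only [Finset.mem_Icc] at hk ⊢; omega
  · simp only [Finset.mem_Icc] at hk ⊢; omega
  · rw [neg_neg, map_mul, ← exp_conj, map_mul, map_mul, conj_ofReal, conj_I, map_intCast,
      Int.cast_neg]
    congr 2
    ring

/-- The product of Fourier sums of degrees `n`, `m` is a Fourier sum of any degree `D ≥ n + m`
(collect the terms `e^{i(k+l)t}` fibrewise). -/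
private theorem fs_mul {n m D : ℕ} (hD : n + m ≤ D) {F G : ℝ → ℂ} {a b : ℤ → ℂ}
    (hF : ∀ t : ℝ, F t = ∑ k ∈ Finset.Icc (-(n : ℤ)) n, a k * exp ((k : ℂ) * (t : ℂ) * I))
    (hG : ∀ t : ℝ, G t = ∑ k ∈ Finset.Icc (-(m : ℤ)) m, b k * exp ((k : ℂ) * (t : ℂ) * I)) :
    ∃ c : ℤ → ℂ, ∀ t : ℝ, F t * G t =
      ∑ k ∈ Finset.Icc (-(D : ℤ)) D, c k * exp ((k : ℂ) * (t : ℂ) * I) := by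
  classical
  refine ⟨fun j => ∑ kl ∈ (Finset.Icc (-(n : ℤ)) n ×ˢ Finset.Icc (-(m : ℤ)) m) with
    kl.1 + kl.2 = j, a kl.1 * b kl.2, fun t => ?_⟩
  have hmaps : ∀ kl ∈ Finset.Icc (-(n : ℤ)) n ×ˢ Finset.Icc (-(m : ℤ)) m,
      kl.1 + kl.2 ∈ Finset.Icc (-(D : ℤ)) D := by
    intro kl hkl
    simp only [Finset.mem_product, Finset.mem_Icc] at hkl ⊢
    omega
  rw [hF t, hG t, Finset.sum_mul_sum, ← Finset.sum_product', ← Finset.sum_fiberwise_of_maps_to hmaps]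
  refine Finset.sum_congr rfl fun j _ => ?_
  rw [Finset.sum_mul]
  refine Finset.sum_congr rfl fun kl hkl => ?_
  rw [← (Finset.mem_filter.mp hkl).2, Int.cast_add, add_mul, add_mul, Complex.exp_add]
  ring

/-- A finite sum of Fourier sums over a fixed frequency set is a Fourier sum over that set. -/
private theorem fs_sum {ι : Type*} [Fintype ι] {S : Finset ℤ} {F : ι → ℝ → ℂ}
    (h : ∀ i, ∃ a : ℤ → ℂ, ∀ t : ℝ, F i t = ∑ k ∈ S, a k * exp ((k : ℂ) * (t : ℂ) * I)) :
    ∃ a : ℤ → ℂ, ∀ t : ℝ, ∑ i, F i t = ∑ k ∈ S, a k * exp ((k : ℂ) * (t : ℂ) * I) := by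
  choose a ha using h
  refine ⟨fun k => ∑ i, a i k, fun t => ?_⟩
  simp_rw [ha, Finset.sum_mul]
  exact Finset.sum_comm

/-- The squared modulus of a Fourier sum of degree `n` is a Fourier sum of any degree `D ≥ 2n`
(`|F|² = F · conj F`). -/
private theorem fs_norm_sq {n D : ℕ} (hD : n + n ≤ D) {F : ℝ → ℂ} {a : ℤ → ℂ}
    (hF : ∀ t : ℝ, F t = ∑ k ∈ Finset.Icc (-(n : ℤ)) n, a k * exp ((k : ℂ) * (t : ℂ) * I)) :
    ∃ c : ℤ → ℂ, ∀ t : ℝ, (((‖F t‖ ^ 2 : ℝ)) : ℂ) =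
      ∑ k ∈ Finset.Icc (-(D : ℤ)) D, c k * exp ((k : ℂ) * (t : ℂ) * I) := by
  obtain ⟨c, hc⟩ := fs_mul hD hF (fs_conj hF)
  exact ⟨c, fun t => by rw [← hc t, ← Complex.normSq_eq_norm_sq, Complex.mul_conj]⟩

end Fourier

/-! ### The stub -/

/-- Registered stub `stub_adjugateSmallBall` of line `adjugate-anticoncentration-pin` for crux stmt-QuantumFields-11513.
RELATIVE SMALL BALLS OF THE COFACTOR BLOCK under the tilted two-star law: there are absolute
`C, p, c > 0` such that for `β ≥ 0`, `|m₀| ≤ 2`, `L ≥ 4`, every background `U` and sites `x, y`,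
with `A = Σ_{a,i,b,j} |adj D_W(refit ·)_{(x,a,i),(y,b,j)}|`, `wt = e^{-β S_W ∘ refit}`, product Haar,
`M = ∫ A wt / ∫ wt > 0`: `∫ 1{A ≤ ε M} wt / ∫ wt ≤ C (1+β)^p ε^c` (adjugate twin of crux
`TiltedFlatness` (b′), same engine; folklore harmonic analysis on compact groups).  THE STATEMENT BELOW IS REGISTERED — DO NOT CHANGE A CHARACTER OF IT. -/
theorem stub_adjugateSmallBall :
    ∃ C p c : ℝ, 0 < C ∧ 0 < c ∧ ∀ β : ℝ, 0 ≤ β → ∀ m₀ : ℝ, -2 ≤ m₀ → m₀ ≤ 2 →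
      ∀ (N : ℕ) [NeZero N], 4 ≤ N → ∀ (U : GaugeConfig 4 N SU3) (x y : TorusSite 4 N)
        (refit : GaugeConfig 4 N SU3 → GaugeConfig 4 N SU3),
        (∀ W e, refit W e = if e.1 = x ∨ Site.shift e.1 e.2 = x ∨ e.1 = y ∨ Site.shift e.1 e.2 = y then W e else U e) →
        ∀ (A wt : GaugeConfig 4 N SU3 → ℝ),
          (∀ W, A W = ∑ a : Fin 3, ∑ i : Fin 4, ∑ b : Fin 3, ∑ j : Fin 4,
            ‖(wilsonDirac (fundamentalRep (Fin 3)) (refit W) m₀ 1).adjugate (x, a, i) (y, b, j)‖) →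
          (∀ W, wt W = Real.exp (-(β * wilsonAction (fundamentalRep (Fin 3)) (refit W)))) →
          ∀ (haar : Measure (GaugeConfig 4 N SU3)), haar = Measure.pi (fun _ => haarProbability SU3) →
          ∀ (M : ℝ), M = (∫ W, A W * wt W ∂haar) / ∫ W, wt W ∂haar → 0 < M → ∀ ε : ℝ, 0 < ε →
            (∫ W, (if A W ≤ ε * M then (1 : ℝ) else 0) * wt W ∂haar) / (∫ W, wt W ∂haar) ≤
              C * (1 + β) ^ p * ε ^ c := by
  -- the engine of crux `TiltedFlatness` at the diagonal circle
  obtain ⟨T, hT⟩ := CircleTransport.exists_diagCircle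
  have hW := CircleTransport.stub_eulerWord T hT
  obtain ⟨C_R, c, hCR, hc, hR⟩ := CircleTransport.stub_haarSmallBalls T hT hW
    (CircleTransport.stub_torusSmallBalls CircleTransport.stub_circleEngine.1
      CircleTransport.stub_circleEngine.2) 48 16
  obtain ⟨C_D, p, hCD, hD⟩ := CircleTransport.tiltDensityBound_of_fibre
    (CircleTransport.stub_actionLipschitz T hT) (CircleTransport.stub_circleUntilt T hT hW)
  refine ⟨C_D * (C_R * 12 ^ c), p, c, by positivity, hc, ?_⟩
  intro β hβ m₀ _hm₁ _hm₂ N _ hN U x y refit hrefit A wt hA hwt haar hhaar M hM hMpos ε hε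
  -- the refit: listed star edges, update identities, continuity
  obtain ⟨sE, hcover, hstar⟩ := CircleTransport.exists_starEdge x y
  have hrefit' : refit = fun W (e : Edge 4 N) =>
      if e.1 = x ∨ Site.shift e.1 e.2 = x ∨ e.1 = y ∨ Site.shift e.1 e.2 = y then W e else U e :=
    funext fun W => funext fun e => hrefit W e
  have hupd : ∀ (i : (Fin 4 ⊕ Fin 4) ⊕ (Fin 4 ⊕ Fin 4)) (W : GaugeConfig 4 N SU3) (g : SU3),
      refit (Function.update W (sE i) g) = Function.update (refit W) (sE i) g := by
    intro i W g
    funext e'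
    by_cases h : e' = sE i
    · subst h; rw [hrefit, Function.update_self, Function.update_self, if_pos (hstar i)]
    · rw [hrefit, Function.update_of_ne h, Function.update_of_ne h, hrefit]
  have hdepR : ∀ W W' : GaugeConfig 4 N SU3, (∀ i, W (sE i) = W' (sE i)) → refit W = refit W' := by
    intro W W' h
    funext e'
    rw [hrefit, hrefit]
    split_ifs with he
    · obtain ⟨i, rfl⟩ := hcover e' he
      exact h i
    · rfl
  have hrefc : Continuous refit := by
    rw [hrefit']
    refine continuous_pi fun e' => ?_
    split_ifs
    exacts [continuous_apply e', continuous_const]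
  -- the cofactor block, entry by entry
  obtain ⟨entry, hentry⟩ : ∃ entry : GaugeConfig 4 N SU3 → Fin 3 × Fin 4 × Fin 3 × Fin 4 → ℂ,
      ∀ W k, entry W k = (wilsonDirac (fundamentalRep (Fin 3)) (refit W) m₀ 1).adjugate
        (x, k.1, k.2.1) (y, k.2.2.1, k.2.2.2) := ⟨_, fun _ _ => rfl⟩
  have hAK : ∀ W, A W = ∑ k, ‖entry W k‖ := fun W => by
    simp only [hA, hentry, Fintype.sum_prod_type]
  have hentryc : ∀ k, Continuous fun W => entry W k := fun k => by
    simp only [hentry]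
    exact ((((continuous_wilsonDirac (fundamentalRep (Fin 3)) (continuous_fundamentalRep (Fin 3))
      m₀ 1).comp hrefc).matrix_adjugate).matrix_elem _ _)
  -- the `ℓ²` block `G = √Q`, `Q = Σ |adj|²`
  obtain ⟨G, hG⟩ : ∃ G : GaugeConfig 4 N SU3 → ℝ, ∀ W, G W = Real.sqrt (∑ k, ‖entry W k‖ ^ 2) :=
    ⟨_, fun _ => rfl⟩
  have hQ0 : ∀ W, 0 ≤ ∑ k, ‖entry W k‖ ^ 2 := fun W => Finset.sum_nonneg fun k _ => sq_nonneg _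
  have hGA : ∀ W, G W ≤ A W := fun W => by
    rw [hG, hAK, Real.sqrt_le_left (Finset.sum_nonneg fun k _ => norm_nonneg _)]
    exact Finset.sum_sq_le_sq_sum_of_nonneg fun k _ => norm_nonneg _
  have hAG : ∀ W, A W ≤ 12 * G W := fun W => by
    rw [hG, hAK]
    have h := sq_sum_le_card_mul_sum_sq (s := Finset.univ) (f := fun k => ‖entry W k‖)
    have hcard : ((Finset.univ : Finset (Fin 3 × Fin 4 × Fin 3 × Fin 4)).card : ℝ) = 12 ^ 2 := by
      norm_num [Finset.card_univ]
    rw [hcard] at h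
    calc ∑ k, ‖entry W k‖ ≤ Real.sqrt (12 ^ 2 * ∑ k, ‖entry W k‖ ^ 2) := Real.le_sqrt_of_sq_le h
      _ = 12 * Real.sqrt (∑ k, ‖entry W k‖ ^ 2) := by
          rw [Real.sqrt_mul (by norm_num), Real.sqrt_sq (by norm_num)]
  have hGc : Continuous G := by
    rw [show G = fun W => Real.sqrt (∑ k, ‖entry W k‖ ^ 2) from funext hG]
    exact Real.continuous_sqrt.comp (continuous_finsetSum _ fun k _ => (hentryc k).norm.pow 2)
  have hdep : ∀ W W' : GaugeConfig 4 N SU3, (∀ i, W (sE i) = W' (sE i)) → G W = G W' := by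
    intro W W' h
    simp only [hG, hentry, hdepR W W' h]
  have hband : ∀ (W : GaugeConfig 4 N SU3) (i : (Fin 4 ⊕ Fin 4) ⊕ (Fin 4 ⊕ Fin 4)) (A' B' : SU3),
      ∃ a : ℤ → ℂ, ∀ t : ℝ,
        ((G (Function.update W (sE i) (A' * T t * B')) ^ 2 : ℝ) : ℂ) =
          ∑ k ∈ Finset.Icc (-((48 : ℕ) : ℤ)) ((48 : ℕ) : ℤ),
            a k * Complex.exp ((k : ℂ) * (t : ℂ) * Complex.I) := by
    intro W i A' B'
    have hk : ∀ k : Fin 3 × Fin 4 × Fin 3 × Fin 4, ∃ b : ℤ → ℂ, ∀ t : ℝ,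
        (((‖entry (Function.update W (sE i) (A' * T t * B')) k‖ ^ 2 : ℝ)) : ℂ) =
          ∑ j ∈ Finset.Icc (-((48 : ℕ) : ℤ)) ((48 : ℕ) : ℤ),
            b j * Complex.exp ((j : ℂ) * (t : ℂ) * Complex.I) := by
      intro k
      obtain ⟨a, ha⟩ := stub_adjugateBandLimit T hT m₀ N hN (refit W) (sE i) A' B'
        (x, k.1, k.2.1) (y, k.2.2.1, k.2.2.2)
      refine fs_norm_sq (n := 24) (by norm_num) (a := a) fun t => ?_
      rw [hentry, hupd]
      simpa only [Nat.cast_ofNat] using ha t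
    obtain ⟨b, hb⟩ := fs_sum hk
    refine ⟨b, fun t => ?_⟩
    rw [hG, Real.sq_sqrt (hQ0 _), Complex.ofReal_sum]
    exact hb t
  -- (R1) for `G`, then for `A`
  have hRG : ∀ W₀, 0 < G W₀ → ∀ η : ℝ, 0 < η →
      ((Measure.pi fun _ : Edge 4 N => haarProbability SU3) {W | G W ≤ η * G W₀}).toReal ≤
        C_R * η ^ c := fun W₀ hW₀ η hη =>
    hR (Edge 4 N) ((Fin 4 ⊕ Fin 4) ⊕ (Fin 4 ⊕ Fin 4)) sE (by simp) G hGc (fun W => by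
      rw [hG]; exact Real.sqrt_nonneg _) hdep hband W₀ hW₀ η hη
  haveI : IsProbabilityMeasure haar := by rw [hhaar]; infer_instance
  have hR1A : ∀ W₀, 0 < A W₀ → ∀ ε : ℝ, 0 < ε →
      (haar {W | A W ≤ ε * A W₀}).toReal ≤ C_R * 12 ^ c * ε ^ c := by
    intro W₀ hW₀ ε hε
    have hG₀ : 0 < G W₀ := by linarith [hAG W₀]
    have hsub : {W | A W ≤ ε * A W₀} ⊆ {W | G W ≤ 12 * ε * G W₀} := by
      intro W hW
      simp only [Set.mem_setOf_eq] at hW ⊢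
      calc G W ≤ A W := hGA W
        _ ≤ ε * A W₀ := hW
        _ ≤ ε * (12 * G W₀) := mul_le_mul_of_nonneg_left (hAG W₀) hε.le
        _ = 12 * ε * G W₀ := by ring
    calc (haar {W | A W ≤ ε * A W₀}).toReal ≤ (haar {W | G W ≤ 12 * ε * G W₀}).toReal :=
          ENNReal.toReal_mono (measure_ne_top _ _) (measure_mono hsub)
      _ ≤ C_R * (12 * ε) ^ c := by rw [hhaar]; exact hRG W₀ hG₀ (12 * ε) (by positivity)
      _ = C_R * 12 ^ c * ε ^ c := by rw [Real.mul_rpow (by norm_num) hε.le]; ring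
  -- the weight: continuity, positivity, density bound
  have hwt' : wt = fun W => Real.exp (-(β * wilsonAction (fundamentalRep (Fin 3)) (refit W))) :=
    funext hwt
  have hSc : Continuous fun W => wilsonAction (fundamentalRep (Fin 3)) (refit W) :=
    (TiltedFlatnessNegative.continuous_wilsonAction (fundamentalRep (Fin 3))
      (continuous_fundamentalRep (Fin 3))).comp hrefc
  have hwtc' : Continuous fun W => Real.exp (-(β * wilsonAction (fundamentalRep (Fin 3)) (refit W))) :=
    Real.continuous_exp.comp ((continuous_const.mul hSc).neg)
  have hwtc : Continuous wt := by rw [hwt']; exact hwtc'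
  have hwt0 : ∀ W, 0 < wt W := fun W => by rw [hwt]; exact Real.exp_pos _
  have hZ : 0 < ∫ W, wt W ∂haar := by
    simp_rw [hwt]
    exact integral_exp_pos (TiltedFlatnessNegative.integrable_of_continuous hwtc')
  have hdens : ∀ W, wt W ≤ C_D * (1 + β) ^ p * ∫ W', wt W' ∂haar := by
    intro W
    rw [← div_le_iff₀ hZ]
    have h := hD β hβ N hN U x y W
    rw [hwt', hhaar, hrefit']
    convert h using 4
  -- the block: continuity, nonnegativity; then the tilted anti-concentration lemma
  have hA0 : ∀ W, 0 ≤ A W := fun W => by rw [hAK]; exact Finset.sum_nonneg fun k _ => norm_nonneg _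
  have hAc : Continuous A := by
    rw [show A = fun W => ∑ k, ‖entry W k‖ from funext hAK]
    exact continuous_finsetSum _ fun k _ => (hentryc k).norm
  have hK : (0 : ℝ) ≤ C_D * (1 + β) ^ p := mul_nonneg hCD.le (Real.rpow_nonneg (by linarith) _)
  obtain ⟨-, hb⟩ :=
    Literature.MeasureTheory.Integral.flatness_and_smallBalls_of_anticoncentration haar hAc hwtc hA0
      (fun W => (hwt0 W).le) hK (by positivity : (0 : ℝ) ≤ C_R * 12 ^ c) hc hZ hdens hR1A
  subst hM
  calc _ ≤ C_D * (1 + β) ^ p * (C_R * 12 ^ c) * ε ^ c := hb hMpos ε hε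
    _ = C_D * (C_R * 12 ^ c) * (1 + β) ^ p * ε ^ c := by ring

end Summit.QuantumFields.QCD.Theorems.AdjugateAnticoncentrationPin

end
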